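import Literature.Geometry.Riemannian.MetricFlowConcentration
import Mathlib.Probability.Kernel.Disintegration.StandardBorel
import Mathlib.Probability.Kernel.Composition.MeasureCompProd
import HarnessLib

/-!
# The triangle inequality for the `W₁`-Wasserstein distance (gluing of couplings)

R. Bamler, *Compactness theory of the space of super Ricci flows*, Invent. Math. 233 (2023), §2.1:
*"`d_{W_p}` defines a complete metric on `𝒫(X)` if we allow it to attain the value `∞`"* — for the
tree's primal `wassersteinW1` (`MetricFlowConcentration.lean`: the infimum of `∫ d dq` over
couplings `q`) the triangle inequality is the classical **gluing lemma** (Villani 2003, Lemma 7.6;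
Villani 2009, pp. 23–24): couplings `q₁₂ ∈ Π(μ₁, μ₂)` and `q₂₃ ∈ Π(μ₂, μ₃)` are disintegrated
along their common marginal `μ₂` and recombined to a measure `γ` on `X × (X × X)` whose
projections are `q₁₂` and `q₂₃`; its `(1, 3)`-projection is a coupling of `μ₁, μ₃` with
`∫ d(x, z) dq₁₃ ≤ ∫ d(x, y) dq₁₂ + ∫ d(y, z) dq₂₃`. On a standard Borel (e.g. Polish) metric space
we prove, with Mathlib's disintegration `Measure.condKernel`:

* `IsCoupling.exists_glue` — the gluing lemma (three spaces; projections onto `q₁₂`, `q₂₃`);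
* `wassersteinW1_triangle` — **`d_{W₁}(μ₁, μ₃) ≤ d_{W₁}(μ₁, μ₂) + d_{W₁}(μ₂, μ₃)`** for
  probability measures;
* `wassersteinW1_self`, `wassersteinW1_comm` — `d_{W₁}(μ, μ) = 0` and symmetry;
* `wassersteinW1_map_le_of_edist_le` — `d_{W₁}(f_* μ, f_* ν) ≤ d_{W₁}(μ, ν)` for distance
  non-increasing measurable `f` (isometric embeddings).

Everything is proved; no definitions, no named facts.

## References

* R. H. Bamler, *Compactness theory of the space of super Ricci flows*, Invent. Math. 233 (2023),
  §2.1 (Wasserstein distance). [Bamler2023]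
* C. Villani, *Topics in Optimal Transportation*, GSM 58 (AMS 2003), Lemma 7.6 (gluing lemma),
  Thm. 7.3 (`W_p` is a metric). [Villani2003]
-/

noncomputable section

open Set MeasureTheory ProbabilityTheory Filter
open scoped Topology ENNReal NNReal ProbabilityTheory

namespace Literature.Geometry.Riemannian

universe u

variable {X : Type u} [MetricSpace X] [MeasurableSpace X] [BorelSpace X]

/-! ### The gluing lemma -/

/-- **Gluing lemma** (Villani 2003, Lemma 7.6): for couplings `q₁₂` of `μ₁, μ₂` (on `X₁ × X₂`)
and `q₂₃` of `μ₂, μ₃` (on `X₂ × X₃`), probability measures with `X₁`, `X₃` standard Borel, there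
is a probability measure `γ` on `X₂ × (X₁ × X₃)` — "`(y, (x, z))`" — with `(x, y)`-projection
`q₁₂` and `(y, z)`-projection `q₂₃`: disintegrate `q₁₂ = ∫ (κ₁(y) ⊗ δ_y) dμ₂(y)`,
`q₂₃ = ∫ (δ_y ⊗ κ₃(y)) dμ₂(y)` (`Measure.condKernel`) and set
`γ := ∫ δ_y ⊗ (κ₁(y) ⊗ κ₃(y)) dμ₂(y)`. [cite: Villani2003, Lemma 7.6] -/
theorem IsCoupling.exists_glue {X₁ X₂ X₃ : Type*} [MeasurableSpace X₁] [MeasurableSpace X₂]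
    [MeasurableSpace X₃] [StandardBorelSpace X₁] [StandardBorelSpace X₃]
    {μ₁ : Measure X₁} {μ₂ : Measure X₂} {μ₃ : Measure X₃}
    {q₁₂ : Measure (X₁ × X₂)} {q₂₃ : Measure (X₂ × X₃)} (h₁₂ : IsCoupling μ₁ μ₂ q₁₂)
    (h₂₃ : IsCoupling μ₂ μ₃ q₂₃) :
    ∃ γ : Measure (X₂ × (X₁ × X₃)), IsProbabilityMeasure γ ∧
      γ.map (fun p ↦ (p.2.1, p.1)) = q₁₂ ∧ γ.map (fun p ↦ (p.1, p.2.2)) = q₂₃ := by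
  obtain ⟨hP₁₂, hf₁₂, hs₁₂⟩ := h₁₂
  obtain ⟨hP₂₃, hf₂₃, hs₂₃⟩ := h₂₃
  -- `X₁`, `X₃` are nonempty (they carry probability measures)
  haveI : Nonempty X₁ := by
    by_contra hX
    rw [not_nonempty_iff] at hX
    have h1 : q₁₂ univ = 1 := measure_univ
    rw [univ_eq_empty_iff.2 inferInstance, measure_empty] at h1
    exact zero_ne_one h1
  haveI : Nonempty X₃ := by
    by_contra hX
    rw [not_nonempty_iff] at hX
    have h1 : q₂₃ univ = 1 := measure_univ
    rw [univ_eq_empty_iff.2 inferInstance, measure_empty] at h1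
    exact zero_ne_one h1
  haveI : IsProbabilityMeasure μ₂ := by rw [← hf₂₃]; infer_instance
  -- disintegrations along the middle marginal `μ₂`
  set ρ₁ : Measure (X₂ × X₁) := q₁₂.map Prod.swap with hρ₁
  haveI : IsProbabilityMeasure ρ₁ := Measure.isProbabilityMeasure_map measurable_swap.aemeasurable
  have hρ₁fst : ρ₁.fst = μ₂ := by
    rw [hρ₁, Measure.fst_map_swap]
    exact hs₁₂
  set κ₁ : Kernel X₂ X₁ := ρ₁.condKernel with hκ₁
  have hdis₁ : μ₂ ⊗ₘ κ₁ = ρ₁ := by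
    have h := ρ₁.disintegrate κ₁
    rwa [hρ₁fst] at h
  set κ₃ : Kernel X₂ X₃ := q₂₃.condKernel with hκ₃
  have hdis₃ : μ₂ ⊗ₘ κ₃ = q₂₃ := by
    have h := q₂₃.disintegrate κ₃
    rwa [hf₂₃] at h
  -- the glued measure
  set γ : Measure (X₂ × (X₁ × X₃)) := μ₂ ⊗ₘ (κ₁ ×ₖ κ₃) with hγ
  haveI : IsProbabilityMeasure γ := by
    rw [hγ]
    infer_instance
  refine ⟨γ, inferInstance, ?_, ?_⟩
  · -- `(x, y)`-projection: integrate out `z`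
    have hmeas : Measurable fun p : X₂ × (X₁ × X₃) ↦ (p.2.1, p.1) :=
      measurable_snd.fst.prodMk measurable_fst
    refine Measure.ext_of_lintegral _ fun f hf ↦ ?_
    rw [lintegral_map hf hmeas, hγ, Measure.lintegral_compProd
      (show Measurable (fun p : X₂ × (X₁ × X₃) ↦ f (p.2.1, p.1)) from hf.comp hmeas)]
    have hq : q₁₂ = ρ₁.map Prod.swap := by
      rw [hρ₁, Measure.map_map measurable_swap measurable_swap]
      simp
    rw [hq, lintegral_map hf measurable_swap, ← hdis₁, Measure.lintegral_compProd
      (show Measurable (fun p : X₂ × X₁ ↦ f p.swap) from hf.comp measurable_swap)]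
    refine lintegral_congr fun y ↦ ?_
    rw [Kernel.prod_apply, lintegral_prod _
      (show Measurable (fun p : X₁ × X₃ ↦ f (p.1, y)) from
        hf.comp (measurable_fst.prodMk measurable_const)).aemeasurable]
    refine lintegral_congr fun x ↦ ?_
    simp only [Prod.swap_prod_mk, lintegral_const, measure_univ, mul_one]
  · -- `(y, z)`-projection: integrate out `x`
    have hmeas : Measurable fun p : X₂ × (X₁ × X₃) ↦ (p.1, p.2.2) :=
      measurable_fst.prodMk measurable_snd.snd
    refine Measure.ext_of_lintegral _ fun f hf ↦ ?_
    rw [lintegral_map hf hmeas, hγ, Measure.lintegral_compProd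
      (show Measurable (fun p : X₂ × (X₁ × X₃) ↦ f (p.1, p.2.2)) from hf.comp hmeas), ← hdis₃,
      Measure.lintegral_compProd hf]
    refine lintegral_congr fun y ↦ ?_
    rw [Kernel.prod_apply, lintegral_prod _
      (show Measurable (fun p : X₁ × X₃ ↦ f (y, p.2)) from
        hf.comp (measurable_const.prodMk measurable_snd)).aemeasurable]
    have h : (fun x : X₁ ↦ ∫⁻ z, f (y, (x, z).2) ∂κ₃ y) = fun _ ↦ ∫⁻ z, f (y, z) ∂κ₃ y := rfl
    rw [h, lintegral_const, measure_univ, mul_one]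

/-! ### The triangle inequality -/

/-- **Triangle inequality for `d_{W₁}`** (Bamler 2023, §2.1: `d_{W₁}` is a metric on `𝒫(X)`
allowed to attain `∞`; Villani 2003, Thm. 7.3 via the gluing Lemma 7.6): for probability measures
`μ₁, μ₂, μ₃` on a standard Borel metric space,
`d_{W₁}(μ₁, μ₃) ≤ d_{W₁}(μ₁, μ₂) + d_{W₁}(μ₂, μ₃)` — the `(1, 3)`-projection of the glued measure
is a coupling of `μ₁, μ₃` of cost at most `∫ d dq₁₂ + ∫ d dq₂₃` (triangle inequality through the
middle point, integrated). [cite: Bamler2023, §2.1 (Wasserstein distance)] [cite: Villani2003, Lemma 7.6] -/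
theorem wassersteinW1_triangle [SecondCountableTopology X] [StandardBorelSpace X]
    (μ₁ μ₂ μ₃ : Measure X) [IsProbabilityMeasure μ₁] [IsProbabilityMeasure μ₃] :
    wassersteinW1 μ₁ μ₃ ≤ wassersteinW1 μ₁ μ₂ + wassersteinW1 μ₂ μ₃ := by
  -- for every pair of couplings
  have hkey : ∀ (q₁₂ : {q : Measure (X × X) // IsCoupling μ₁ μ₂ q})
      (q₂₃ : {q : Measure (X × X) // IsCoupling μ₂ μ₃ q}),
      wassersteinW1 μ₁ μ₃ ≤ ∫⁻ p, edist p.1 p.2 ∂(q₁₂ : Measure (X × X)) +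
        ∫⁻ p, edist p.1 p.2 ∂(q₂₃ : Measure (X × X)) := by
    rintro ⟨q₁₂, h₁₂⟩ ⟨q₂₃, h₂₃⟩
    obtain ⟨γ, hγP, hγ₁₂, hγ₂₃⟩ := h₁₂.exists_glue h₂₃
    have hm₁₂ : Measurable fun p : X × (X × X) ↦ (p.2.1, p.1) :=
      measurable_snd.fst.prodMk measurable_fst
    have hm₂₃ : Measurable fun p : X × (X × X) ↦ (p.1, p.2.2) :=
      measurable_fst.prodMk measurable_snd.snd
    have hm₁₃ : Measurable fun p : X × (X × X) ↦ (p.2.1, p.2.2) := measurable_snd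
    -- the `(1, 3)`-projection is a coupling of `μ₁, μ₃`
    set q₁₃ : Measure (X × X) := γ.map (fun p ↦ (p.2.1, p.2.2)) with hq₁₃
    have hc₁₃ : IsCoupling μ₁ μ₃ q₁₃ := by
      refine ⟨Measure.isProbabilityMeasure_map hm₁₃.aemeasurable, ?_, ?_⟩
      · rw [hq₁₃, Measure.fst, Measure.map_map measurable_fst hm₁₃, ← h₁₂.2.1, ← hγ₁₂, Measure.fst,
          Measure.map_map measurable_fst hm₁₂]
        rfl
      · rw [hq₁₃, Measure.snd, Measure.map_map measurable_snd hm₁₃, ← h₂₃.2.2, ← hγ₂₃, Measure.snd,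
          Measure.map_map measurable_snd hm₂₃]
        rfl
    -- its cost
    have hcost : ∫⁻ p, edist p.1 p.2 ∂q₁₃ ≤
        ∫⁻ p, edist p.1 p.2 ∂q₁₂ + ∫⁻ p, edist p.1 p.2 ∂q₂₃ := by
      rw [hq₁₃, lintegral_map measurable_edist hm₁₃, ← hγ₁₂, ← hγ₂₃,
        lintegral_map measurable_edist hm₁₂, lintegral_map measurable_edist hm₂₃,
        ← lintegral_add_left (measurable_snd.fst.edist measurable_fst)]
      exact lintegral_mono fun p ↦ edist_triangle p.2.1 p.1 p.2.2
    exact (wassersteinW1_le_lintegral hc₁₃).trans hcost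
  -- take infima
  calc wassersteinW1 μ₁ μ₃
      ≤ ⨅ (q₁₂ : {q : Measure (X × X) // IsCoupling μ₁ μ₂ q})
          (q₂₃ : {q : Measure (X × X) // IsCoupling μ₂ μ₃ q}),
          (∫⁻ p, edist p.1 p.2 ∂(q₁₂ : Measure (X × X)) +
            ∫⁻ p, edist p.1 p.2 ∂(q₂₃ : Measure (X × X))) :=
        le_iInf fun q₁₂ ↦ le_iInf fun q₂₃ ↦ hkey q₁₂ q₂₃
    _ = wassersteinW1 μ₁ μ₂ + wassersteinW1 μ₂ μ₃ := by
        simp_rw [← ENNReal.add_iInf, ← ENNReal.iInf_add]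
        rfl

/-- **`d_{W₁}(μ, μ) = 0`** (the diagonal coupling `(id, id)_* μ` has cost `0`).
[cite: Bamler2023, §2.1 (Wasserstein distance)] -/
theorem wassersteinW1_self [SecondCountableTopology X] (μ : Measure X) [IsProbabilityMeasure μ] : wassersteinW1 μ μ = 0 := by
  refine le_antisymm ?_ bot_le
  have hm : Measurable fun x : X ↦ (x, x) := measurable_id.prodMk measurable_id
  have hc : IsCoupling μ μ (μ.map fun x ↦ (x, x)) := by
    refine ⟨Measure.isProbabilityMeasure_map hm.aemeasurable, ?_, ?_⟩
    · rw [Measure.fst, Measure.map_map measurable_fst hm]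
      exact Measure.map_id
    · rw [Measure.snd, Measure.map_map measurable_snd hm]
      exact Measure.map_id
  refine (wassersteinW1_le_lintegral hc).trans (le_of_eq ?_)
  rw [lintegral_map measurable_edist hm]
  simp

omit [BorelSpace X] in
/-- **Symmetry of `d_{W₁}`** (swap the couplings; any metric space, no measurability issue thanks
to `lintegral_map_equiv` for the measurable equivalence `Prod.swap`).
[cite: Bamler2023, §2.1 (Wasserstein distance)] -/
theorem wassersteinW1_comm (μ ν : Measure X) : wassersteinW1 μ ν = wassersteinW1 ν μ := by
  suffices h : ∀ μ ν : Measure X, wassersteinW1 ν μ ≤ wassersteinW1 μ ν from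
    le_antisymm (h ν μ) (h μ ν)
  intro μ ν
  refine le_iInf fun q ↦ ?_
  obtain ⟨q, hqP, hq1, hq2⟩ := q
  haveI := hqP
  have hc : IsCoupling ν μ (q.map Prod.swap) :=
    ⟨Measure.isProbabilityMeasure_map measurable_swap.aemeasurable,
      by rw [Measure.fst_map_swap]; exact hq2, by rw [Measure.snd_map_swap]; exact hq1⟩
  refine (wassersteinW1_le_lintegral hc).trans (le_of_eq ?_)
  rw [show (Prod.swap : X × X → X × X) = ⇑(MeasurableEquiv.prodComm : X × X ≃ᵐ X × X) from rfl,
    lintegral_map_equiv]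
  simp only [MeasurableEquiv.prodComm, MeasurableEquiv.coe_mk, Equiv.prodComm_apply,
    Prod.fst_swap, Prod.snd_swap]
  simp_rw [edist_comm]

omit [BorelSpace X] in
/-- **Push-forward by a distance non-increasing map does not increase `d_{W₁}`**: for a
measurable `f : X → Y` with `d(f a, f b) ≤ d(a, b)` (e.g. an isometric embedding),
`d_{W₁}(f_* μ, f_* ν) ≤ d_{W₁}(μ, ν)` — push the couplings forward by `f × f`
(`lintegral_map_le`). Used for the Gromov–`W₁` distance (Bamler 2023, §2.4).
[cite: Bamler2023, §2.1 (Wasserstein distance)] -/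
theorem wassersteinW1_map_le_of_edist_le {Y : Type*} [MetricSpace Y] [MeasurableSpace Y]
    {f : X → Y} (hf : Measurable f) (hle : ∀ a b, edist (f a) (f b) ≤ edist a b)
    (μ ν : Measure X) : wassersteinW1 (μ.map f) (ν.map f) ≤ wassersteinW1 μ ν := by
  refine le_iInf fun q ↦ ?_
  obtain ⟨q, hqP, hq1, hq2⟩ := q
  haveI := hqP
  have hm : Measurable (Prod.map f f) := hf.prodMap hf
  have hc : IsCoupling (μ.map f) (ν.map f) (q.map (Prod.map f f)) := by
    refine ⟨Measure.isProbabilityMeasure_map hm.aemeasurable, ?_, ?_⟩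
    · rw [Measure.fst, Measure.map_map measurable_fst hm, ← hq1, Measure.fst,
        Measure.map_map hf measurable_fst]
      rfl
    · rw [Measure.snd, Measure.map_map measurable_snd hm, ← hq2, Measure.snd,
        Measure.map_map hf measurable_snd]
      rfl
  refine (wassersteinW1_le_lintegral hc).trans ?_
  refine (lintegral_map_le _ _).trans ?_
  exact lintegral_mono fun p ↦ hle p.1 p.2

end Literature.Geometry.Riemannian

end
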